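import Summits.CriticalPhenomena.CardyFormulaZ2.Theses.CardySelfRefinement
import Summits.CriticalPhenomena.CardyFormulaZ2.Theorems.CardySelfRefinementLagHandOffQuadCompactness
import Summits.CriticalPhenomena.CardyFormulaZ2.Theorems.CardySelfRefinementLagHandOffTranslation
import Summits.CriticalPhenomena.CardyFormulaZ2.Theorems.CardySelfRefinementLagHandOffCovariance
import Summits.CriticalPhenomena.CardyFormulaZ2.Theorems.CardySelfRefinementLagHandOffChordal
import Summits.CriticalPhenomena.CardyFormulaZ2.Theorems.CardySelfRefinementLagHandOffMarkovKernel
import Summits.CriticalPhenomena.CardyFormulaZ2.Theorems.CardySelfRefinementLagHandOffLocalityPassage2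
import Summits.CriticalPhenomena.CardyFormulaZ2.Theorems.LagHandOff.Negative.ArcSwapStubs
import Summits.CriticalPhenomena.CardyFormulaZ2.Theorems.LagHandOff.Negative.Structure
import Literature.Probability.Percolation.QuadCrossingSpaceZ2
import Literature.Probability.Percolation.QuadCrossingSubseqLimits

/-!
# Skeleton line `crosscut-dictionary` for crux `LagHandOff` (stmt-CriticalPhenomena-10268)

LEAD-OWNED copy (prover-line-stmt-CriticalPhenomena-10268-0, picked 2026-08-15): stub names and
signatures are the registered ones; landed stubs are imported and their `sorry` replaced in place.

Route `CardySelfRefinement`, crux r4 `LagHandOff` =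
`RotationInput → ScaleInvariantLimits → (i) ∧ (ii)`.  Clause (i) (eventual measurability of the
interfaces of a discretisation family) is a theorem (refuter cdisprove, `Disproof.lean`,
`lagHandOff_clause_i`; re-proved below verbatim so that this file does not import a work file).
All the weight is clause (ii): along every mesh sequence, ONE subsequence and ONE local Markov
chordal family `P` serving every Dobrushin domain `D` and every admissible `ℤ²`-discretisation
family `E`.

## The line (idea card `crosscut-dictionary`, crux-ideate r1 ideator 2; triage r1: 3 × pass)

THE CROSS-CUT DICTIONARY (Holden–Sun, arXiv:1905.13207 §6.6 Prop. 6.25, transplanted from `𝕋`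
to `ℤ²` subsequential limits): the first-hitting side of a smooth cross-cut `ρ` of `(D; a, b)` by
the interface is ONE quad-crossing event of the Schramm–Smirnov configuration `ω ∈ ℋ_ℂ` (exact on
the lattice; kit j006763 identity I3, 163 840 exhaustive + 4 650 sampled configurations, 0
failures), so the interface is `μ`-a.s. a Borel, similarity-EQUIVARIANT functional
`Ψ_D : ℋ_ℂ → CurveClass ℂ` of the full-plane configuration, E-blind, with JOINT convergence
`(ω_δ, γ_δ^{D,E}) → (ω, Ψ_D ω)` along every quad-convergent mesh sequence (`stub_crosscutDictionary`,
the load-bearing stub = the idea's `CrosscutDictionary` + Transfer C⁺).  Then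
`P D := (Ψ_D)_* μ` and:
* ONE `φ` for ALL `(D, E)`: `φ` is any subsequence along which the full-plane quad laws converge
  (`stub_quadCompactness`, SS11 Cor. 1.6: `ℋ_ℂ` is compact metrisable — tree theorems
  `QuadConfig.compactSpace`, `SchrammSmirnov2011_thm_1_4_holds`);
* similarity covariance of `P` is a PUSH-FORWARD (`stub_covarianceFromDictionary` = the idea's
  `CovarianceFromDictionary`): `Ψ` is equivariant and `μ` is invariant under rotations
  (`RotationInput`, used here and only here), dilations (`ScaleInvariantLimits`, used here and
  only here) and translations (`stub_translationInput` = the idea's `TranslationInput`: lattice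
  translations are exact, `z2QuadLaw_map_translate_meshPoint`; density of `δₙℤ²` + continuity of
  the translation action on `ℋ`);
* chordality, LSW locality (restriction form), target independence and a.s. no boundary tracing
  of `P` come from EXACT lattice identities + E-blind joint convergence + boundary RSW
  (`stub_freeAxioms`), once every Dobrushin domain is known to be `ℤ²`-discretisable
  (`stub_discretisable`, so that the lattice pins `P D` for EVERY `D` — triage r1 check 6);
* the set-based domain Markov property is the fresh-configuration kernel in lined slit domains
  (`stub_markovPassage`; the natural merge point with line `fresh-quads-markov-kernel` /
  `stopping-hull-markov`).

`LagHandOff_of` composes the seven stubs into the crux BY NAME (kernel-checked, no `sorry`).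

## Disproof used (Cruxes/LagHandOff/Disproof.lean, cdisprove cycle 1, 476 lines, rc 0)
* `conclusion_false_without_discretisation_guard` — honoured: `HandsOff` (inside
  `IsCrosscutDictionary`) is stated under `ZdDiscretisationFamily D E` only; it is consumed at
  `stub_crosscutDictionary` / `stub_freeAxioms` (lattice identities need admissible data).
* `conclusion_false_without_mesh_positivity` — honoured: `QuadConvergent` carries `∀ n, 0 < δs n`;
  `stub_quadCompactness` and every lattice identity live at positive mesh.
* vacuity channels `hyps_of_subseqQuadLimits_eq_empty / _subset_zero` — NOT exploited, CLOSED: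
  `stub_quadCompactness` makes `Λ ≠ ∅`; `isProbabilityMeasure_of_isSubseqQuadLimit` (tree,
  `QuadCrossingSubseqLimits.lean`) makes every `μ ∈ Λ` a probability measure.
* `arcFamily_traces_boundary` — the no-tracing clause is proved in `stub_freeAxioms` from
  boundary arm estimates, not from the axioms.
* `lagHandOff_clause_i` — clause (i) re-proved below (`clause_i`), verbatim.
* `not_lagHandOff_iff` — consistent: both antecedents are used, at `stub_covarianceFromDictionary`.
No landed `Negative/` lemma exists for this crux (nothing to import); no stub is an instance of a
refuted statement (`ledger negatives --problem CriticalPhenomena`: 7 entries, none on quad →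
interface transfer).

## Cycle 2 reshape (lead, 2026-08-16, after wave 1 + drefute notes)

LANDED and now IMPORTED (same namespace, so the sorried copies are deleted here):
`stub_quadCompactness` (p71502, …QuadCompactness.lean), `stub_translationInput` (p71750,
…Translation.lean), `stub_covarianceFromDictionary` (p71518, …Covariance.lean); helpers
`isChordal_of_handsOff` (p72122, …Chordal.lean: the IsChordal conjunct of the old STUB 6 in full),
`stub_freeAxioms_localityPassage` / `isLocal_of_handsOff` / `isTargetIndependent_of_handsOff`
(p73640, …LocalityPassage.lean, with …CommonPrefix p72549, …JointReadings p72920, …StopMeasurable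
p72110), `isDomainMarkov_map_of_freshSlitHandOff` + `isDomainMarkov_iff_exists_slitKernel`
(p72346, …MarkovKernel.lean), discretisation infrastructure (…DiscretisableForcing p72481,
…DiscretisableArcs p72561, …DiscretisableLabelling p72857); clause (i) is imported from the
disprover's landed `Theorems/LagHandOff/Negative/Structure.lean` (`lagHandOff_clause_i`).

RESHAPED open stubs (7, all in tree vocabulary):
* `stub_crosscutDictionary` — ENLARGED to what the composition really consumes from the transfer
  technology: the Jordan-domain dictionary `Ψ` (measurable, equivariant, hands-off) AND a slit
  extension `Φ (U; x, b)` with the fresh-configuration hand-off identity under every `μ ∈ Λ`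
  (stub-worker 7's `stub-misstated` finding: `domain`/`initial`/per-`F` `markov` are bookkeeping —
  landed — and the whole content of the Markov passage is this hand-off in lined slit domains).
  THE crux-sized stub (promotion candidate).
* `stub_carrierDetermines` — NEW (drefute R1, in tree vocabulary): the hand-off family depends on
  `(carrier, a, b)` only.  Co-oriented half = E-blindness (M); the orientation-reversed half is
  the ARC-SWAP duality statement (self-duality of bond-ℤ² lands on the half-mesh-shifted lattice:
  needs an offset hands-off, drefute R2) — L/XL.
* `stub_discreteLocality` — NEW, CORRECTED form of stub-worker 6's `hdisc` (which is false for
  orientation-mismatched nested pairs and when `a ∈ closure (D ∖ D')`): escape disjunct at `a`,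
  and the smaller domain's family may discretise ANY same-carrier same-marks `D''`.
* `stub_discreteSplitting` — NEW (= stub-worker 6's `hdiscT`, exact lattice target independence
  for compatible families of the two chords of a 3-marked domain).
* `stub_localityPassage2` — NEW (M): the landed locality passage re-run with the corrected
  discrete hypotheses + `stub_carrierDetermines` + chordality at the escape disjunct.
* `stub_noTrace` — NEW (XL): the no-boundary-tracing conjunct (boundary arm estimates for bond-ℤ²
  in rough Jordan domains; nothing in tree).
* `stub_discretisable` — unchanged (blueprint: drefute `Discretisable.md`; residual = no-tie
  clause in the o(1)-window at `a`, `b`, stub-worker 5's condition (NF)).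
Dropped as registered stubs: `stub_freeAxioms` (= Chordal [landed] + localityPassage2 + noTrace),
`stub_markovPassage` (closed modulo the enlarged dictionary by `isDomainMarkov_map_of_freshSlitHandOff`).

## Cycle 3 integration (lead, 2026-08-16, after wave 2)

LANDED in wave 2 and now IMPORTED: `stub_localityPassage2` (p74694, …LocalityPassage2.lean — the
corrected locality passage, a THEOREM now), `stub_carrierDetermines_coOriented` (p75921,
…CarrierCoOriented.lean), `stub_carrierDetermines_arcDichotomy` + `eq_of_coOriented_of_reversed`
(p75011, …CarrierArcs.lean), `stub_discreteLocality_explorationPrefix` (p75027,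
…ExplorationPrefix.lean), `stub_discreteLocality_explorationSuffix` (p75991,
…ExplorationSuffix.lean).  RESHAPE: `stub_carrierDetermines` is DELETED as a stub — for the
dictionary's own reading it is the disprover's landed 3-liner
`Negative.carrierDetermines_of_slitExtension` fed by the field `hext` of the enlarged
`stub_crosscutDictionary` (drefute g2, `Theorems/LagHandOff/Negative/ArcSwapStubs.lean`): the
arc-swap universality is thereby paid INSIDE the dictionary stub (where the slit explorer
`Φ (U; x, b)` is blind to which arc is wired), not in a separate stub.
OPEN registered stubs after cycle 3 (5): `stub_crosscutDictionary` (XL, held — promotion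
candidate), `stub_discreteLocality`, `stub_discreteSplitting` (compatible admissible
discretisations of nested / re-targeted domains; deterministic prefix/suffix groundwork landed),
`stub_noTrace` (XL, boundary arm estimates in rough Jordan domains), `stub_discretisable`
(marker-free reduction landed; residual = no-tie clause at the cut).
-/


noncomputable section

open MeasureTheory Filter Set Topology
open scoped BoundedContinuousFunction
open Literature.Probability.Percolation Literature.Probability.LatticeModels
open Literature.Probability.RandomPlanarGeometry Literature.Probability.Percolation.QuadCrossing
open Summit.CriticalPhenomena.CardyFormulaZ2.Theses.CardySelfRefinement

namespace Summit.CriticalPhenomena.CardyFormulaZ2.Cruxes.LagHandOff.CrosscutDictionary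

/-! ### Vocabulary of the line (documentation and glue only — every registered `stub_*` below is
stated in TREE vocabulary) -/

/-- The Schramm–Smirnov space `ℋ = ℋ_ℂ` of full-plane quad-crossing configurations. -/
abbrev ℋ : Type := QuadConfig (Set.univ : Set ℂ)

/-- `δs` is a positive mesh sequence tending to `0` along which the full-plane quad-crossing laws
of bond-`ℤ²` converge weakly to `μ` (so `μ ∈ subseqQuadLimits univ`, `isSubseqQuadLimit_iff`). -/
def QuadConvergent (δs : ℕ → ℝ) (μ : FiniteMeasure ℋ) : Prop :=
  (∀ n, 0 < δs n) ∧ Tendsto δs atTop (𝓝 0) ∧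
    Tendsto (fun n => z2QuadLaw (Set.univ : Set ℂ) (δs n)) atTop (𝓝 μ)

/-- The chordal family read off `μ` by `Ψ`: `P D := (Ψ D)_* μ`. -/
def lawFamily (Ψ : DobrushinDomain → ℋ → CurveClass ℂ) (μ : FiniteMeasure ℋ) : ChordalFamily :=
  fun D => (μ : Measure ℋ).map (Ψ D)

/-! ### The five registered stubs (tree vocabulary only) -/

/-- STUB `stub_crosscutDictionary` (XL, LOAD-BEARING, promotion candidate) — THE CROSS-CUT
DICTIONARY WITH ITS SLIT EXTENSION.  There are a Borel, similarity-equivariant reading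
`Ψ D : ℋ → CurveClass ℂ` of the chordal interface of every Dobrushin domain off the full-plane
quad configuration, to which the bond-`ℤ²` interfaces of EVERY admissible discretisation family
hand off JOINTLY along EVERY quad-convergent positive mesh sequence (Holden–Sun Prop. 6.25
transplanted to `ℤ²` sublimits: hitting side of a cross-cut = one crossing bit; SS11 Lemma 5.1;
KS17 regularity; AB99 tightness), AND an explorer `Φ (U; x, b)` of (interface-lined) slit domains
extending it in law (`hext`), measurable along pasts (`hmeas`), with the FRESH-CONFIGURATION
HAND-OFF identity (`hfresh`): under every `μ ∈ Λ`, the law of (past, future) of `Ψ D` at the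
first hitting of any closed `F` disintegrates through `past ↦ (Φ (remainingDomain D past;
past.target, b))_* μ` — the weak limit of the exact lattice disintegration at the stopping set
of explored edges (unexplored edges fresh; KS17 Prop. 4.7; GPS13 p. 16's fractal-boundary
caveat).  Everything open in the crux lives here. -/
theorem stub_crosscutDictionary :
    ∃ (Ψ : DobrushinDomain → QuadConfig (Set.univ : Set ℂ) → CurveClass ℂ) (Φ : Set ℂ → ℂ → ℂ → QuadConfig (Set.univ : Set ℂ) → CurveClass ℂ), (∀ D : DobrushinDomain, Measurable (Ψ D)) ∧ (∀ (D : DobrushinDomain) (c : ℂ) (hc : c ≠ 0) (w : ℂ) (S : QuadConfig (Set.univ : Set ℂ)), Ψ (D.map (similarity c hc w)) (S.mapHomeomorph (similarity c hc w)) = (Ψ D S).map (similarity c hc w : C(ℂ, ℂ))) ∧ (∀ (μ : FiniteMeasure (QuadConfig (Set.univ : Set ℂ))) (δs : ℕ → ℝ), (∀ n, 0 < δs n) → Tendsto δs atTop (𝓝 0) → Tendsto (fun n => z2QuadLaw (Set.univ : Set ℂ) (δs n)) atTop (𝓝 μ) → ∀ (D : DobrushinDomain) (E : ℝ → DiscreteDobrushin),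 ZdDiscretisationFamily D E → ∀ f : (QuadConfig (Set.univ : Set ℂ) × CurveClass ℂ) →ᵇ ℝ, Tendsto (fun n => ∫ ω, f (z2QuadConfig (Set.univ : Set ℂ) (δs n) ω, bondInterfaceIn D (E (δs n)) ω) ∂(bondPercolation (zdGraph 2) half)) atTop (𝓝 (∫ S, f (S, Ψ D S) ∂(μ : Measure (QuadConfig (Set.univ : Set ℂ)))))) ∧ ∀ μ ∈ subseqQuadLimits (Set.univ : Set ℂ), (∀ D : DobrushinDomain, (μ : Measure (QuadConfig (Set.univ : Set ℂ))).map (Φ D.carrier (D.pt 0) (D.pt 1)) = (μ : Measure (QuadConfig (Set.univ : Set ℂ))).map (Ψ D)) ∧ (∀ (D : DobrushinDomain) (T : Set (CurveClass ℂ)), MeasurableSet T → Measurable fun p : CurveClass ℂ => (μ : Measure (QuadConfig (Set.univ : Set ℂ))).map (Φ (remainingDomain D p) p.target (D.pt 1)) T) ∧ (∀ (D : DobrushinDomain) (F : Set ℂ), IsClosed F → ∀ S T : Set (CurveClass ℂ), MeasurableSet S → MeasurableSet T → (μ : Measure (QuadConfig (Set.univ : Set ℂ))) ((Ψ D) ⁻¹'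 (CurveClass.stopAt F ⁻¹' S ∩ CurveClass.startFrom F ⁻¹' T)) = ∫⁻ ω in (Ψ D) ⁻¹' (CurveClass.stopAt F ⁻¹' S), (μ : Measure (QuadConfig (Set.univ : Set ℂ))).map (Φ (remainingDomain D ((Ψ D ω).stopAt F)) ((Ψ D ω).stopAt F).target (D.pt 1)) T ∂(μ : Measure (QuadConfig (Set.univ : Set ℂ)))) := by
  sorry

/-- STUB `stub_discreteLocality` (L/XL; discrete + discretisability) — EXACT LATTICE LOCALITY for
nested Dobrushin domains `D' ⊆ D` with the same marked points: unless `a ∈ closure (D ∖ D')`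
(then locality is trivial: both stopped curves are a.s. the constant curve `a`), there are
admissible families `E` of `D` and `E'` of SOME same-carrier same-marks version `D''` of `D'`
(the prover picks the orientation: `D'' = D'` or its reversal, whichever is co-wired with `D`)
whose interfaces, for every `ω`, either coincide or share a parametrised prefix ending within
`ρ` of `closure (D ∖ D')`, eventually in `δ` for every `ρ > 0` (the medial exploration reads only
edges adjacent to its past; compatible data: `Ω'_δ ⊆ Ω_δ`, same start edge `e_a`, same labels away
from the new boundary).  Corrected form of stub-worker 6's `hdisc`. -/
theorem stub_discreteLocality :
    ∀ D D' : DobrushinDomain, D'.carrier ⊆ D.carrier → D'.pt 0 = D.pt 0 → D'.pt 1 = D.pt 1 → D.pt 0 ∈ closure (D.carrier \ D'.carrier) ∨ ∃ (D'' : DobrushinDomain) (E E' : ℝ → DiscreteDobrushin), D''.carrier = D'.carrier ∧ D''.pt 0 = D'.pt 0 ∧ D''.pt 1 = D'.pt 1 ∧ ZdDiscretisationFamily D E ∧ ZdDiscretisationFamily D'' E' ∧ ∀ ρ : ℝ, 0 < ρ → ∀ᶠ δ in nhdsWithin (0 : ℝ) (Set.Ioi 0), ∀ ω : BondConfig (Site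 2), bondInterfaceIn D' (E' δ) ω = bondInterfaceIn D (E δ) ω ∨ ∃ (c c' : Curve ℂ) (s : unitInterval), CurveClass.mk c = bondInterfaceIn D' (E' δ) ω ∧ CurveClass.mk c' = bondInterfaceIn D (E δ) ω ∧ (∀ t : unitInterval, t ≤ s → c t = c' t) ∧ c s ∈ Metric.cthickening ρ (closure (D.carrier \ D'.carrier)) := by
  sorry

/-- STUB `stub_discreteSplitting` (L; discrete + discretisability) — EXACT LATTICE TARGET
INDEPENDENCE: for a 3-marked domain `(D; a, b, b')` there are admissible families of the chords
`(D; a, b)` and `(D; a, b')` (same start edge, same labels off `[b, b']`) whose interfaces, for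
every `ω`, coincide or share a parametrised prefix ending within `ρ` of the arc `[b, b'] = D.arc 1`
(the two boundary conditions differ exactly on `[b, b']`).  (= stub-worker 6's `hdiscT`.) -/
theorem stub_discreteSplitting :
    ∀ D : MarkedDomain 3, ∃ E₁ E₂ : ℝ → DiscreteDobrushin, ZdDiscretisationFamily (D.chord 0 1 (by decide)) E₁ ∧ ZdDiscretisationFamily (D.chord 0 2 (by decide)) E₂ ∧ ∀ ρ : ℝ, 0 < ρ → ∀ᶠ δ in nhdsWithin (0 : ℝ) (Set.Ioi 0), ∀ ω : BondConfig (Site 2), bondInterfaceIn (D.chord 0 1 (by decide)) (E₁ δ) ω = bondInterfaceIn (D.chord 0 2 (by decide)) (E₂ δ) ω ∨ ∃ (c c' : Curve ℂ) (s : unitInterval), CurveClass.mk c = bondInterfaceIn (D.chord 0 1 (by decide)) (E₁ δ) ω ∧ CurveClass.mk c' = bondInterfaceIn (D.chord 0 2 (by decide)) (E₂ δ) ω ∧ (∀ t : unitInterval, t ≤ s → c t = c' t) ∧ c s ∈ Metric.cthickening ρ (D.arc 1) := by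
  sorry

/-- STUB `stub_noTrace` (XL) — the hand-off family a.s. traces no boundary arc: a curve running
along a non-trivial sub-arc of `∂D` forces, in disjoint balls centred on that sub-arc, one-arm
events of the primal cluster of the wired arc (resp. the dual cluster of the free arc) from the
lattice scale to the ball scale inside `D`; RSW in the (possibly rough) Jordan domain makes their
joint probability vanish; portmanteau.  Nothing of this is in the tree for bond-`ℤ²` in general
Jordan domains (`HalfPlaneThreeArm.lean` is site-`𝕋`; `ZdDomArmEvents.lean` has the events, no
bounds). -/
theorem stub_noTrace :
    ∀ Ψ : DobrushinDomain → QuadConfig (Set.univ : Set ℂ) → CurveClass ℂ, (∀ D : DobrushinDomain, Measurable (Ψ D)) → (∀ (μ : FiniteMeasure (QuadConfig (Set.univ : Set ℂ))) (δs : ℕ → ℝ), (∀ n, 0 < δs n) → Tendsto δs atTop (𝓝 0) → Tendsto (fun n => z2QuadLaw (Set.univ : Set ℂ) (δs n)) atTop (𝓝 μ) → ∀ (D : DobrushinDomain) (E : ℝ → DiscreteDobrushin), ZdDiscretisationFamily D E → ∀ f : (QuadConfig (Set.univ : Set ℂ) × CurveClass ℂ) →ᵇ ℝ, Tendsto (fun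 n => ∫ ω, f (z2QuadConfig (Set.univ : Set ℂ) (δs n) ω, bondInterfaceIn D (E (δs n)) ω) ∂(bondPercolation (zdGraph 2) half)) atTop (𝓝 (∫ S, f (S, Ψ D S) ∂(μ : Measure (QuadConfig (Set.univ : Set ℂ)))))) → (∀ D : DobrushinDomain, ∃ E : ℝ → DiscreteDobrushin, ZdDiscretisationFamily D E) → ∀ μ ∈ subseqQuadLimits (Set.univ : Set ℂ), ∀ D : DobrushinDomain, ∀ᵐ γ ∂((μ : Measure (QuadConfig (Set.univ : Set ℂ))).map (Ψ D)), ∀ c : Curve ℂ, CurveClass.mk c = γ → ∀ s t : unitInterval, s < t → c '' Set.Icc s t ⊆ frontier D.carrier → (c '' Set.Icc s t).Subsingleton := by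
  sorry

/-- STUB `stub_discretisable` (L on paper, XL in Lean) — every Dobrushin domain is
`ℤ²`-DISCRETISABLE (admissible G02 data at all small meshes, arcs and marked points converging).
Blueprint: drefute `Cruxes/LagHandOff/DrefuteDiscretisable.md` (solidity lemma, chord cells,
non-bypassed cut near `a`, `b`); infrastructure landed by stub-worker 5
(…DiscretisableForcing/Arcs/Labelling: `zdDiscretisationFamily_of_labelling` reduces the stub to
a marker-free labelling of `zdBoundary` with no forced site, correct sides and two good cut
edges); residual = the no-tie clause `IsZdAdmissible.disjoint` in the `o(1)`-window at `a`, `b`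
(condition (NF) of `exists_mem_zdDiscreteArc_of_closedBall_subset`). -/
theorem stub_discretisable :
    ∀ D : DobrushinDomain, ∃ E : ℝ → DiscreteDobrushin, ZdDiscretisationFamily D E := by
  sorry

/-! ### The composition: the five stubs + the landed helpers imply the crux, by name -/

/-- `LagHandOff` from the registered stubs and the landed helpers (pure logic + `integral_map`;
no `sorry` of its own).  Clause (i): the disprover's landed `lagHandOff_clause_i`.  Clause (ii):
`stub_quadCompactness` (landed) picks `φ` and `μ ∈ Λ`; `stub_crosscutDictionary` gives `Ψ, Φ`;
`P := lawFamily Ψ μ`; chordal by `isChordal_of_handsOff` (landed) + `stub_discretisable`;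
covariant by `stub_covarianceFromDictionary` (landed) fed by the antecedents and
`stub_translationInput` (landed); Markov by `isDomainMarkov_map_of_freshSlitHandOff` (landed) fed
by the slit fields of the dictionary; local + target independent by `stub_localityPassage2` (landed) fed by
`Negative.carrierDetermines_of_slitExtension` (landed; from the dictionary's `hext`),
`stub_discreteLocality`, `stub_discreteSplitting`; no tracing by
`stub_noTrace`; convergence = the curve marginal of the hands-off. -/
theorem LagHandOff_of :
    Summit.CriticalPhenomena.CardyFormulaZ2.Theses.CardySelfRefinement.LagHandOff := by
  intro hRot hScale
  refine ⟨fun D E hE =>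
    Summit.CriticalPhenomena.CardyFormulaZ2.Theorems.LagHandOff.Negative.lagHandOff_clause_i D E hE,
    ?_⟩
  intro δs hpos hlim
  obtain ⟨φ, hφ, μ, hμ⟩ := stub_quadCompactness δs hpos hlim
  have hconv : QuadConvergent (δs ∘ φ) μ :=
    ⟨fun n => hpos (φ n), hlim.comp hφ.tendsto_atTop, hμ⟩
  have hΛ : μ ∈ subseqQuadLimits (Set.univ : Set ℂ) :=
    (isSubseqQuadLimit_iff Set.univ μ).mpr ⟨δs ∘ φ, hconv.1, hconv.2.1, hconv.2.2⟩
  obtain ⟨Ψ, Φ, h1, h2, h3, hslit⟩ := stub_crosscutDictionary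
  obtain ⟨hext, hmeas, hfresh⟩ := hslit μ hΛ
  have hch := isChordal_of_handsOff Ψ h1 h3 stub_discretisable μ hΛ
  have hcar := Summit.CriticalPhenomena.CardyFormulaZ2.Theorems.LagHandOff.Negative.carrierDetermines_of_slitExtension
    Ψ Φ fun ν hν => (hslit ν hν).1
  obtain ⟨hloc, hti⟩ := stub_localityPassage2 Ψ h1 h3 stub_discretisable hcar
    stub_discreteLocality stub_discreteSplitting μ hΛ
  have hmk := isDomainMarkov_map_of_freshSlitHandOff Ψ Φ (μ : Measure ℋ) h1 hext hmeas hfresh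
  have hcov := stub_covarianceFromDictionary Ψ h1 h2 μ (hRot μ hΛ) (hScale μ hΛ)
    (stub_translationInput μ hΛ)
  have hnt := stub_noTrace Ψ h1 h3 stub_discretisable μ hΛ
  refine ⟨φ, hφ, lawFamily Ψ μ, ⟨hch, hcov, hmk, hloc, hti⟩, hnt, ?_⟩
  intro D E hE f
  have h := h3 μ (δs ∘ φ) hconv.1 hconv.2.1 hconv.2.2 D E hE
    (f.compContinuous ⟨Prod.snd, continuous_snd⟩)
  have hmap : ∫ γ, f γ ∂(lawFamily Ψ μ D) = ∫ S, f (Ψ D S) ∂(μ : Measure ℋ) :=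
    integral_map (h1 D).aemeasurable f.continuous.aestronglyMeasurable
  rw [hmap]
  simpa only [BoundedContinuousFunction.compContinuous_apply, ContinuousMap.coe_mk,
    Function.comp_apply] using h

/-- The crux, by name (lead's closing theorem: sorry-free once every `stub_*` is replaced by its
landed helper; its type is literally the route decl). -/
theorem lagHandOff_proof :
    Summit.CriticalPhenomena.CardyFormulaZ2.Theses.CardySelfRefinement.LagHandOff :=
  LagHandOff_of

end Summit.CriticalPhenomena.CardyFormulaZ2.Cruxes.LagHandOff.CrosscutDictionary

end
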